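import Summits.CriticalPhenomena.Ising3DConformalLimit.Theorems.ExistsScaleCovariantLimit.Negative.DyadicIdentity
import Summits.CriticalPhenomena.Ising3DConformalLimit.Theorems.ExistsScaleCovariantLimit.Negative.DyadicTwoPrimesDensity
import HarnessLib

/-!
# Two primes fix the scale (crux `ExistsScaleCovariantLimit`, item stmt-CriticalPhenomena-1981;
line `Sketch` = `two-hierarchies-force-the-filter`, stub `stub_scaleCovariantOfTwoThree`)

The model-free engine of the line, pure analysis on a family `S : CorrFamily 3` of `n`-point
functions on `(ℝ³)ⁿ` (no lattice object is mentioned). If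

* `S₂(0, e₀) = 1`,
* every `S n` is continuous on `NonCoincident 3 n`,
* `S₂(0, 2e₀) > 0`, `S₂(0, 3e₀) > 0`, and
* `S` is self-consistent under the two dilations `2` and `3`:
  `S n x = S₂(0, c e₀)^{-n/2} · S n (c·x)` on `NonCoincident`, `c = 2, 3`,

then `S` is EXACTLY scale covariant on non-coincident configurations with SOME exponent `Δ`:
`S n (c·x) = c^{-nΔ} S n x` for all `c > 0`.

Proof. Call `c > 0` GOOD if `S n (c·x) = Ψ(c)ⁿ S n x` on `NonCoincident` with
`Ψ(c) = S₂(0, c e₀)^{1/2} > 0`. Good scales form a subgroup of `ℝ₊ˣ` (`good_mul`, `good_inv`,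
`good_zpow`) which is closed (`good_of_tendsto`, by continuity of `S` off the diagonals) and contains
`2` and `3` (`good_of_selfConsistent`); `{2^a 3^b : a, b ∈ ℤ}` is dense in `(0, ∞)` since
`log 3 / log 2 ∉ ℚ` (`exists_seq_two_three_tendsto`, landed in
`Theorems/ExistsScaleCovariantLimit/Negative/DyadicTwoPrimesDensity.lean`), so every `c > 0` is good;
finally `Ψ` is multiplicative, positive and continuous on `(0, ∞)`, hence a power `c ↦ c^κ`
(`t ↦ log Ψ(eᵗ)` is a continuous additive map `ℝ →+ ℝ`, hence linear: `map_real_smul`), and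
`Δ = -κ`.

Ported from the standing disprover's `Cruxes/ExistsScaleCovariantLimit/Disproof.lean` §J
(section `TwoThree`: `Psi`, `Good`, `cfg0_smul`, `two_cfg0_of_good`, `good_of_selfConsistent`,
`good_mul`, `good_inv`, `good_pow`, `good_zpow`, `good_of_tendsto`, `scaleCovariant_of_two_three`),
cdisprove cycle 2 — a Cruxes module that Theorems files may not import; the abbreviations `cfg0`,
`Psi`, `Good` of the source are local notations here (no new definitions). [folklore]
-/

noncomputable section
namespace Summit.CriticalPhenomena.Ising3DConformalLimit.Cruxes.ExistsScaleCovariantLimit.TwoHierarchies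
open Literature.Probability.LatticeModels Filter Set
open scoped Topology
open Summit.CriticalPhenomena.Ising3DConformalLimit.MoebiusLimitExistsOnlyInteraction (rhoPin)

open Summit.CriticalPhenomena.Ising3DConformalLimit.ExistsScaleCovariantLimitNegative.Dyadic
  (smul_cfg01 cfg0_mem exists_seq_two_three_tendsto)

/-- `cfg0[s]`: the axis pair `(0, s e₀)`; `Ψ[S, c] = S₂(0, c e₀)^{1/2}`, the would-be scale factor of
the dilation `c`; `Good[S, c]`: `c > 0`, `Ψ[S, c] > 0` and `S` is exactly `Ψ[S, c]`-covariant under the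
dilation `c` on non-coincident configurations (local notations, no new definitions). -/
local notation3 (prettyPrint := false) "cfg0[" s "]" =>
  (![0, EuclideanSpace.single 0 s] : Fin 2 → EuclideanSpace ℝ (Fin 3))

local notation3 (prettyPrint := false) "Ψ[" S ", " c "]" => Real.sqrt (S 2 cfg0[c])

local notation3 (prettyPrint := false) "Good[" S ", " c "]" =>
  0 < c ∧ 0 < Ψ[S, c] ∧
    ∀ n : ℕ, ∀ x ∈ NonCoincident 3 n, S n (fun i => c • x i) = Ψ[S, c] ^ n * S n x

variable {S : CorrFamily 3}

/-! ### Good scales: a closed subgroup of `ℝ₊ˣ` -/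

/-- Dilating the axis pair: `c • (0, s e₀) = (0, (c s) e₀)`. [folklore] -/
theorem smul_cfg0 (c s : ℝ) : (fun i => c • cfg0[s] i) = cfg0[c * s] := by
  rw [← smul_cfg01 (c * s), ← smul_cfg01 s]
  funext i
  simp [mul_smul]

/-- For a good `c`: `S₂(0, c e₀) = Ψ(c)²` (given `S₂(0, e₀) = 1`). [folklore] -/
theorem two_cfg0_of_good (h1 : S 2 cfg0[1] = 1) {c : ℝ} (hc : Good[S, c]) :
    S 2 cfg0[c] = Ψ[S, c] ^ 2 := by
  have h := hc.2.2 2 _ (cfg0_mem one_ne_zero)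
  rw [smul_cfg0, mul_one, h1, mul_one] at h
  exact h

/-- **Goodness from an integer self-consistency** `S n x = A^{-n/2} S n (c·x)` with
`A = S₂(0, c e₀) > 0`. [folklore] -/
theorem good_of_selfConsistent {c : ℝ} (hc : 0 < c) (hA : 0 < S 2 cfg0[c])
    (h : ∀ n : ℕ, ∀ x ∈ NonCoincident 3 n,
      S n x = (S 2 cfg0[c]) ^ (-(n:ℝ) / 2) * S n (fun i => c • x i)) :
    Good[S, c] := by
  have hPsi : 0 < Ψ[S, c] := Real.sqrt_pos.2 hA
  refine ⟨hc, hPsi, fun n x hx => ?_⟩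
  have e := h n x hx
  have hpow : (S 2 cfg0[c]) ^ (-(n:ℝ) / 2) * Ψ[S, c] ^ n = 1 := by
    rw [Real.sqrt_eq_rpow, ← Real.rpow_natCast, ← Real.rpow_mul hA.le, ← Real.rpow_add hA]
    have : -(n:ℝ) / 2 + 1 / 2 * n = 0 := by ring
    rw [this, Real.rpow_zero]
  calc S n (fun i => c • x i)
      = ((S 2 cfg0[c]) ^ (-(n:ℝ) / 2) * Ψ[S, c] ^ n) * S n (fun i => c • x i) := by
        rw [hpow, one_mul]
    _ = Ψ[S, c] ^ n * ((S 2 cfg0[c]) ^ (-(n:ℝ) / 2) * S n (fun i => c • x i)) := by ring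
    _ = Ψ[S, c] ^ n * S n x := by rw [← e]

/-- The composite dilation of two good scales: `S n ((cd)·x) = (Ψ(c)Ψ(d))ⁿ S n x`. [folklore] -/
theorem smul_mul_of_good {c d : ℝ} (hc : Good[S, c]) (hd : Good[S, d]) {n : ℕ}
    {x : Fin n → EuclideanSpace ℝ (Fin 3)} (hx : x ∈ NonCoincident 3 n) :
    S n (fun i => (c * d) • x i) = (Ψ[S, c] * Ψ[S, d]) ^ n * S n x := by
  have hdx : (fun i => d • x i) ∈ NonCoincident 3 n := smul_mem_nonCoincident hd.1.ne' hx
  have e1 := hc.2.2 n _ hdx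
  have e2 := hd.2.2 n x hx
  simp only [mul_smul]
  rw [e1, e2, mul_pow]
  ring

/-- `Ψ` is multiplicative on good scales: `Ψ(cd) = Ψ(c)Ψ(d)` (given `S₂(0, e₀) = 1`). [folklore] -/
theorem psi_mul_of_good (h1 : S 2 cfg0[1] = 1) {c d : ℝ} (hc : Good[S, c]) (hd : Good[S, d]) :
    Ψ[S, c * d] = Ψ[S, c] * Ψ[S, d] := by
  have h2 := smul_mul_of_good hc hd (cfg0_mem one_ne_zero)
  rw [smul_cfg0, mul_one, h1, mul_one] at h2
  rw [h2, Real.sqrt_sq (mul_nonneg (Real.sqrt_nonneg _) (Real.sqrt_nonneg _))]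

/-- Products of good scales are good. [folklore] -/
theorem good_mul (h1 : S 2 cfg0[1] = 1) {c d : ℝ} (hc : Good[S, c]) (hd : Good[S, d]) :
    Good[S, c * d] := by
  refine ⟨mul_pos hc.1 hd.1, ?_, fun n x hx => ?_⟩
  · rw [psi_mul_of_good h1 hc hd]; exact mul_pos hc.2.1 hd.2.1
  · rw [psi_mul_of_good h1 hc hd]; exact smul_mul_of_good hc hd hx

/-- Inverses of good scales are good. [folklore] -/
theorem good_inv (h1 : S 2 cfg0[1] = 1) {c : ℝ} (hc : Good[S, c]) : Good[S, c⁻¹] := by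
  have hci : 0 < c⁻¹ := inv_pos.2 hc.1
  have hinv : ∀ n : ℕ, ∀ x ∈ NonCoincident 3 n,
      S n (fun i => c⁻¹ • x i) = (Ψ[S, c])⁻¹ ^ n * S n x := by
    intro n x hx
    have hcx : (fun i => c⁻¹ • x i) ∈ NonCoincident 3 n := smul_mem_nonCoincident hci.ne' hx
    have e := hc.2.2 n _ hcx
    simp only [smul_smul, mul_inv_cancel₀ hc.1.ne', one_smul] at e
    have hne : Ψ[S, c] ^ n ≠ 0 := pow_ne_zero n hc.2.1.ne'
    rw [inv_pow, eq_inv_mul_iff_mul_eq₀ hne, ← e]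
  have hPsi : Ψ[S, c⁻¹] = (Ψ[S, c])⁻¹ := by
    have h2 := hinv 2 _ (cfg0_mem one_ne_zero)
    rw [smul_cfg0, mul_one, h1, mul_one] at h2
    rw [h2, Real.sqrt_sq (inv_nonneg.2 (Real.sqrt_nonneg _))]
  refine ⟨hci, ?_, fun n x hx => ?_⟩
  · rw [hPsi]; exact inv_pos.2 hc.2.1
  · rw [hPsi]; exact hinv n x hx

/-- The trivial scale `1` is good (given `S₂(0, e₀) = 1`). [folklore] -/
theorem good_one (h1 : S 2 cfg0[1] = 1) : Good[S, (1:ℝ)] := by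
  refine ⟨one_pos, ?_, fun n x _ => ?_⟩
  · rw [h1, Real.sqrt_one]; exact one_pos
  · rw [h1, Real.sqrt_one, one_pow, one_mul]; simp

/-- Natural powers of good scales are good. [folklore] -/
theorem good_pow (h1 : S 2 cfg0[1] = 1) {c : ℝ} (hc : Good[S, c]) (m : ℕ) : Good[S, c ^ m] := by
  induction m with
  | zero => rw [pow_zero]; exact good_one h1
  | succ m ih => rw [pow_succ]; exact good_mul h1 ih hc

/-- Integer powers of good scales are good. [folklore] -/
theorem good_zpow (h1 : S 2 cfg0[1] = 1) {c : ℝ} (hc : Good[S, c]) (a : ℤ) : Good[S, c ^ a] := by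
  rcases Int.eq_nat_or_neg a with ⟨m, rfl | rfl⟩
  · rw [zpow_natCast]; exact good_pow h1 hc m
  · rw [zpow_neg, zpow_natCast]; exact good_inv h1 (good_pow h1 hc m)

/-- **Limits of good scales are good** (continuity of `S` off the diagonals): the covariance law
passes to the limit, and `Ψ(c) > 0` since otherwise `S₂(0, e₀) = S₂(c • (0, c⁻¹e₀)) = 0`.
[folklore] -/
theorem good_of_tendsto (h1 : S 2 cfg0[1] = 1) (hcont : ∀ n : ℕ, ContinuousOn (S n) (NonCoincident 3 n))
    {u : ℕ → ℝ} {c : ℝ} (hc : 0 < c) (hu : ∀ j, Good[S, u j]) (hut : Tendsto u atTop (𝓝 c)) :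
    Good[S, c] := by
  -- convergence of `S n (u_j • x)` and of `Ψ(u_j)`
  have hSx : ∀ n : ℕ, ∀ x ∈ NonCoincident 3 n,
      Tendsto (fun j => S n (fun i => u j • x i)) atTop (𝓝 (S n (fun i => c • x i))) := by
    intro n x hx
    have hcx : (fun i => c • x i) ∈ NonCoincident 3 n := smul_mem_nonCoincident hc.ne' hx
    have hcw : ContinuousWithinAt (S n) (NonCoincident 3 n) (fun i => c • x i) := hcont n _ hcx
    refine hcw.tendsto.comp (tendsto_nhdsWithin_iff.2 ⟨?_, Filter.Eventually.of_forall fun j =>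
      smul_mem_nonCoincident (hu j).1.ne' hx⟩)
    exact tendsto_pi_nhds.2 fun i => hut.smul tendsto_const_nhds
  have hPsi : Tendsto (fun j => Ψ[S, u j]) atTop (𝓝 Ψ[S, c]) := by
    have h := hSx 2 _ (cfg0_mem one_ne_zero)
    simp_rw [smul_cfg0, mul_one] at h
    exact h.sqrt
  have hlaw : ∀ n : ℕ, ∀ x ∈ NonCoincident 3 n, S n (fun i => c • x i) = Ψ[S, c] ^ n * S n x := by
    intro n x hx
    refine tendsto_nhds_unique (hSx n x hx) ?_
    have : Tendsto (fun j => Ψ[S, u j] ^ n * S n x) atTop (𝓝 (Ψ[S, c] ^ n * S n x)) :=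
      (hPsi.pow n).mul tendsto_const_nhds
    exact this.congr fun j => ((hu j).2.2 n x hx).symm
  refine ⟨hc, ?_, hlaw⟩
  -- positivity of `Ψ(c)`: otherwise `S₂(0,e₀) = S₂(c • (0, c⁻¹e₀)) = 0`
  rcases (Real.sqrt_nonneg (S 2 cfg0[c])).eq_or_lt with h0 | hpos
  · exfalso
    have h := hlaw 2 _ (cfg0_mem (inv_ne_zero hc.ne'))
    rw [smul_cfg0, mul_inv_cancel₀ hc.ne', h1, ← h0] at h
    simp at h
  · exact hpos

/-! ### Two primes fix the scale -/

/-- **Two primes fix the scale.** If `S₂(0,e₀) = 1`, `S` is continuous off the diagonals, and `S` is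
self-consistent under the two dilations `2` and `3` (`S n x = S₂(0,ce₀)^{-n/2} S n (c·x)`, `c = 2, 3`,
with `S₂(0,2e₀), S₂(0,3e₀) > 0`), then `S` is scale covariant on non-coincident configurations with
some exponent `Δ`: every `c > 0` is good (density of `{2^a3^b}` = irrationality of `log 3/log 2`,
closedness of good scales), and a continuous multiplicative `Ψ` is a power. [folklore] -/
theorem scaleCovariant_of_two_three (h1 : S 2 cfg0[1] = 1)
    (hcont : ∀ n : ℕ, ContinuousOn (S n) (NonCoincident 3 n))
    (hA : 0 < S 2 cfg0[2]) (hB : 0 < S 2 cfg0[3])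
    (hC2 : ∀ n : ℕ, ∀ x ∈ NonCoincident 3 n,
      S n x = (S 2 cfg0[2]) ^ (-(n:ℝ) / 2) * S n (fun i => (2:ℝ) • x i))
    (hC3 : ∀ n : ℕ, ∀ x ∈ NonCoincident 3 n,
      S n x = (S 2 cfg0[3]) ^ (-(n:ℝ) / 2) * S n (fun i => (3:ℝ) • x i)) :
    ∃ Δ : ℝ, ∀ (n : ℕ) (c : ℝ), 0 < c → ∀ x ∈ NonCoincident 3 n,
      S n (fun i => c • x i) = c ^ (-(n:ℝ) * Δ) * S n x := by
  have g2 : Good[S, (2:ℝ)] := good_of_selfConsistent two_pos hA hC2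
  have g3 : Good[S, (3:ℝ)] := good_of_selfConsistent (by norm_num) hB hC3
  -- every `c > 0` is good
  have hall : ∀ c : ℝ, 0 < c → Good[S, c] := by
    intro c hc
    obtain ⟨u, hu⟩ := exists_seq_two_three_tendsto hc
    exact good_of_tendsto h1 hcont hc
      (fun j => good_mul h1 (good_zpow h1 g2 _) (good_zpow h1 g3 _)) hu
  -- `Ψ` is multiplicative, positive, continuous on `(0,∞)`
  have hmul : ∀ c d : ℝ, 0 < c → 0 < d → Ψ[S, c * d] = Ψ[S, c] * Ψ[S, d] :=
    fun c d hc hd => psi_mul_of_good h1 (hall c hc) (hall d hd)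
  have hPsi1 : Ψ[S, (1:ℝ)] = 1 := by rw [h1, Real.sqrt_one]
  have hcontPsi : ContinuousOn (fun c : ℝ => Ψ[S, c]) (Set.Ioi 0) := by
    intro c hc
    have hcx : cfg0[c] ∈ NonCoincident 3 2 := cfg0_mem (ne_of_gt hc)
    have hcw : ContinuousWithinAt (S 2) (NonCoincident 3 2) cfg0[c] := hcont 2 _ hcx
    have hmap : Tendsto (fun c' : ℝ => cfg0[c']) (𝓝[Set.Ioi 0] c) (𝓝[NonCoincident 3 2] cfg0[c]) := by
      refine tendsto_nhdsWithin_iff.2 ⟨?_, ?_⟩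
      · have : Continuous fun c' : ℝ => (fun i => c' • cfg0[1] i) :=
          continuous_pi fun i => continuous_id.smul continuous_const
        have h := (this.tendsto c).mono_left (nhdsWithin_le_nhds (s := Set.Ioi (0:ℝ)))
        rw [smul_cfg01] at h
        exact h.congr fun c' => smul_cfg01 c'
      · filter_upwards [self_mem_nhdsWithin] with c' hc'
        exact cfg0_mem (ne_of_gt hc')
    exact (hcw.tendsto.comp hmap).sqrt
  -- `t ↦ log Ψ(eᵗ)` is additive and continuous, hence linear
  let f : ℝ →+ ℝ :=
    { toFun := fun t => Real.log Ψ[S, Real.exp t]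
      map_zero' := by
        show Real.log Ψ[S, Real.exp 0] = 0
        rw [Real.exp_zero, hPsi1, Real.log_one]
      map_add' := fun s t => by
        show Real.log Ψ[S, Real.exp (s + t)] =
          Real.log Ψ[S, Real.exp s] + Real.log Ψ[S, Real.exp t]
        rw [Real.exp_add, hmul _ _ (Real.exp_pos s) (Real.exp_pos t),
          Real.log_mul (hall _ (Real.exp_pos s)).2.1.ne' (hall _ (Real.exp_pos t)).2.1.ne'] }
  have hfc : Continuous f := by
    show Continuous fun t => Real.log Ψ[S, Real.exp t]
    have h1' : Continuous fun t => Ψ[S, Real.exp t] :=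
      hcontPsi.comp_continuous Real.continuous_exp fun t => Real.exp_pos t
    exact h1'.log fun t => (hall _ (Real.exp_pos t)).2.1.ne'
  set κ : ℝ := f 1 with hκ
  have hlin : ∀ t : ℝ, Real.log Ψ[S, Real.exp t] = t * κ := by
    intro t
    have := map_real_smul f hfc t 1
    simp only [smul_eq_mul, mul_one] at this
    exact this
  -- `Ψ(c) = c^κ`
  have hpow : ∀ c : ℝ, 0 < c → Ψ[S, c] = c ^ κ := by
    intro c hc
    have h := hlin (Real.log c)
    rw [Real.exp_log hc] at h
    have hP := (hall c hc).2.1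
    calc Ψ[S, c] = Real.exp (Real.log Ψ[S, c]) := (Real.exp_log hP).symm
      _ = Real.exp (Real.log c * κ) := by rw [h]
      _ = c ^ κ := by rw [Real.rpow_def_of_pos hc]
  refine ⟨-κ, fun n c hc x hx => ?_⟩
  rw [(hall c hc).2.2 n x hx, hpow c hc, ← Real.rpow_natCast, ← Real.rpow_mul hc.le,
    show κ * (n:ℝ) = -(n:ℝ) * -κ by ring]

/-- **Stub `stub_scaleCovariantOfTwoThree` of line `Sketch`** (crux `ExistsScaleCovariantLimit`, item
stmt-CriticalPhenomena-1981): TWO PRIMES FIX THE SCALE — a family `S : CorrFamily 3` with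
`S₂(0, e₀) = 1`, continuous off the diagonals, positive at `(0, 2e₀)`, `(0, 3e₀)` and self-consistent
under the dilations `2` and `3` is exactly scale covariant on non-coincident configurations with some
exponent `Δ` (`scaleCovariant_of_two_three`). [folklore] -/
theorem stub_scaleCovariantOfTwoThree : ∀ S : CorrFamily 3, S 2 (![0, EuclideanSpace.single 0 1] : Fin 2 → EuclideanSpace ℝ (Fin 3)) = 1 → (∀ n : ℕ, ContinuousOn (S n) (NonCoincident 3 n)) → 0 < S 2 (![0, EuclideanSpace.single 0 2] : Fin 2 → EuclideanSpace ℝ (Fin 3)) → 0 < S 2 (![0, EuclideanSpace.single 0 3] : Fin 2 → EuclideanSpace ℝ (Fin 3)) → (∀ n : ℕ, ∀ x ∈ NonCoincident 3 n, S n x = (S 2 (![0, EuclideanSpace.single 0 2] : Fin 2 → EuclideanSpace ℝ (Fin 3))) ^ (-(n:ℝ) / 2) * S n (fun i => (2:ℝ) • x i)) → (∀ n : ℕ, ∀ x ∈ NonCoincident 3 n, S n x = (S 2 (![0, EuclideanSpace.single 0 3] : Fin 2 → EuclideanSpace ℝ (Fin 3))) ^ (-(n:ℝ) / 2) * S n (fun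 i => (3:ℝ) • x i)) → ∃ Δ : ℝ, ∀ (n : ℕ) (c : ℝ), 0 < c → ∀ x ∈ NonCoincident 3 n, S n (fun i => c • x i) = c ^ (-(n:ℝ) * Δ) * S n x := by
  intro S h1 hcont hA hB hC2 hC3
  exact scaleCovariant_of_two_three h1 hcont hA hB hC2 hC3

end Summit.CriticalPhenomena.Ising3DConformalLimit.Cruxes.ExistsScaleCovariantLimit.TwoHierarchies

end
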